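import Mathlib.Geometry.Manifold.Diffeomorph
import Mathlib.Geometry.Manifold.ContMDiff.Constructions
import HarnessLib

/-!
# Reparametrising a flow by an invariant time function: the diffeomorphism `x ↦ θ(τ(x), x)`

General differential topology (topic `Geometry/Manifold`), written for the Dehn–Nielsen–Baer seat
(`Literature/Topology/FourManifolds/DehnNielsenBaerSurface.lean`: Dehn twists on an explicit
surface in `ℝ³` are to be produced as reparametrised flow maps of vector fields tangent to the level
sets of the defining function).  The classical **twist map** of the annulus,
`T(θ, t) = (θ + 2πt, t)` (Farb–Margalit, *A primer on mapping class groups* (2012), §3.1.1), is the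
time-`2πt` map of the rotation flow, the time depending on the point only through the invariant
coordinate `t`; this file records that construction for an arbitrary global flow.

Let `θ : ℝ × M → M` be a `C^n` global flow on a manifold `M` (`θ(0, x) = x`,
`θ(t, θ(s, x)) = θ(t + s, x)`, jointly `C^n` — the output of
`Literature.Geometry.Manifold.exists_contMDiff_globalFlow_of_complete` /
`exists_contMDiff_globalFlow_of_eq_zero_off_isCompact`), and let `τ : M → ℝ` be a `C^n` function
**constant along the orbits**, `τ(θ(t, x)) = τ(x)`.  Then

* `flowReparam θ τ : x ↦ θ(τ x, x)` is `C^n` (`contMDiff_flowReparam`), and is inverted by the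
  reparametrised map of `-τ` (`flowReparam_neg_flowReparam`), hence
* `flowReparamDiffeomorph` — **`x ↦ θ(τ x, x)` is a diffeomorphism of `M`**;
* it maps every orbit into itself, preserves every flow-invariant function
  (`apply_flowReparam_of_invariant`: `F ∘ θ_t = F ⇒ F ∘ T = F` — for the level function of a
  regular sublevel set this is what makes `T` restrict to the boundary), is the identity where
  `τ = 0` (`flowReparam_of_eq_zero`) and, more generally, wherever `τ x` is a period of `x`
  (`flowReparam_of_period`: `θ(τ x, x) = x`), and commutes with the flow (`flowReparam_flow`).

Everything is proved; the two definitions are the map and the diffeomorphism (no named facts,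
D-0026).  Not here: the construction of invariant time functions with prescribed values (period
functions of families of closed orbits), which is where the analysis of a Dehn twist lies.

## References

* B. Farb, D. Margalit, *A primer on mapping class groups*, PMS 49 (2012), §3.1.1 (PDF p. 62: the
  twist map `T(θ, t) = (θ + 2πt, t)`). [FarbMargalit2012]
* J. M. Lee, *Introduction to Smooth Manifolds*, 2nd ed., GTM 218 (2012), Thm. 9.12 (global flows:
  each time-`t` map is a diffeomorphism with inverse the time-`(-t)` map). [LeeSmoothManifolds2013]
-/

open scoped Manifold ContDiff Topology
open Set Function

noncomputable section

namespace Literature.Geometry.Manifold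

section FlowReparamAlgebra

variable {M : Type*}

/-- **The reparametrised flow map** `x ↦ θ(τ x, x)` of a flow `θ` by a time function `τ`.
[cite: FarbMargalit2012, §3.1.1] -/
def flowReparam (θ : ℝ × M → M) (τ : M → ℝ) (x : M) : M := θ (τ x, x)

/-- Unfolding. [folklore] -/
@[simp] theorem flowReparam_apply (θ : ℝ × M → M) (τ : M → ℝ) (x : M) :
    flowReparam θ τ x = θ (τ x, x) := rfl

/-- Where the time function vanishes the reparametrised map is the identity. [folklore] -/
theorem flowReparam_of_eq_zero {θ : ℝ × M → M} {τ : M → ℝ} (h0 : ∀ x, θ (0, x) = x) {x : M}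
    (hx : τ x = 0) : flowReparam θ τ x = x := by
  rw [flowReparam_apply, hx, h0]

/-- Where the value of the time function is a period of the point, the reparametrised map is the
identity (the mechanism by which a Dehn twist is the identity beyond the far edge of its annulus:
there the time is a full period). [cite: FarbMargalit2012, §3.1.1] -/
theorem flowReparam_of_period {θ : ℝ × M → M} {τ : M → ℝ} {x : M} (hx : θ (τ x, x) = x) :
    flowReparam θ τ x = x := hx

/-- The reparametrised map moves each point along its own orbit. [folklore] -/
theorem flowReparam_mem_orbit (θ : ℝ × M → M) (τ : M → ℝ) (x : M) :
    flowReparam θ τ x ∈ Set.range fun t : ℝ => θ (t, x) := ⟨τ x, rfl⟩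

/-- **A flow-invariant function is invariant under the reparametrised map.** [folklore] -/
theorem apply_flowReparam_of_invariant {θ : ℝ × M → M} {τ : M → ℝ} {β : Type*} {F : M → β}
    (hF : ∀ t x, F (θ (t, x)) = F x) (x : M) : F (flowReparam θ τ x) = F x :=
  hF (τ x) x

/-- **The reparametrised map of `-τ` inverts that of `τ`** when `τ` is constant along the orbits
(group law: `θ(-τ x, θ(τ x, x)) = θ(0, x) = x`). [cite: LeeSmoothManifolds2013, Thm. 9.12] -/
theorem flowReparam_neg_flowReparam {θ : ℝ × M → M} {τ : M → ℝ} (h0 : ∀ x, θ (0, x) = x)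
    (hadd : ∀ t s x, θ (t, θ (s, x)) = θ (t + s, x)) (hinv : ∀ t x, τ (θ (t, x)) = τ x) (x : M) :
    flowReparam θ (fun y => -τ y) (flowReparam θ τ x) = x := by
  simp only [flowReparam_apply]
  rw [hinv, hadd, neg_add_cancel, h0]

/-- Symmetrically, the map of `τ` inverts that of `-τ`. [cite: LeeSmoothManifolds2013, Thm. 9.12] -/
theorem flowReparam_flowReparam_neg {θ : ℝ × M → M} {τ : M → ℝ} (h0 : ∀ x, θ (0, x) = x)
    (hadd : ∀ t s x, θ (t, θ (s, x)) = θ (t + s, x)) (hinv : ∀ t x, τ (θ (t, x)) = τ x) (x : M) :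
    flowReparam θ τ (flowReparam θ (fun y => -τ y) x) = x := by
  have h := flowReparam_neg_flowReparam (τ := fun y => -τ y) h0 hadd (fun t x => by rw [hinv]) x
  simpa only [neg_neg] using h

/-- The reparametrised map commutes with the flow. [folklore] -/
theorem flowReparam_flow {θ : ℝ × M → M} {τ : M → ℝ}
    (hadd : ∀ t s x, θ (t, θ (s, x)) = θ (t + s, x)) (hinv : ∀ t x, τ (θ (t, x)) = τ x)
    (t : ℝ) (x : M) : flowReparam θ τ (θ (t, x)) = θ (t, flowReparam θ τ x) := by
  simp only [flowReparam_apply]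
  rw [hinv, hadd, hadd, add_comm]

/-- Iterating: the reparametrised maps of two time functions, the second invariant, compose to that
of the sum. [folklore] -/
theorem flowReparam_flowReparam {θ : ℝ × M → M} {τ σ : M → ℝ}
    (hadd : ∀ t s x, θ (t, θ (s, x)) = θ (t + s, x)) (hinv : ∀ t x, σ (θ (t, x)) = σ x) (x : M) :
    flowReparam θ σ (flowReparam θ τ x) = flowReparam θ (fun y => σ y + τ y) x := by
  simp only [flowReparam_apply]
  rw [hinv, hadd]

/-- **A time function factoring through a first integral is constant along the orbits**: if
`h ∘ θ_t = h` then `λ ∘ h` is invariant (the form in which invariant time functions arise for a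
Dehn twist: `λ` a bump times the period, `h` the coordinate across the annulus). [folklore] -/
theorem invariant_comp_of_invariant {θ : ℝ × M → M} {β : Type*} {h : M → β}
    (hh : ∀ t x, h (θ (t, x)) = h x) (lam : β → ℝ) (t : ℝ) (x : M) :
    (lam ∘ h) (θ (t, x)) = (lam ∘ h) x := by
  simp only [comp_apply, hh]

end FlowReparamAlgebra

section FlowReparamSmooth

variable {E : Type*} [NormedAddCommGroup E] [NormedSpace ℝ E] {H : Type*} [TopologicalSpace H]
  {I : ModelWithCorners ℝ E H} {M : Type*} [TopologicalSpace M] [ChartedSpace H M]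
  {n : WithTop ℕ∞}

/-- **The reparametrised flow map is `C^n`** if the flow is jointly `C^n` and the time function is
`C^n`. [cite: LeeSmoothManifolds2013, Thm. 9.12] -/
theorem contMDiff_flowReparam {θ : ℝ × M → M} {τ : M → ℝ}
    (hθ : ContMDiff (𝓘(ℝ, ℝ).prod I) I n θ) (hτ : ContMDiff I 𝓘(ℝ, ℝ) n τ) :
    ContMDiff I I n (flowReparam θ τ) :=
  hθ.comp (hτ.prodMk contMDiff_id)

/-- **The reparametrised flow map `x ↦ θ(τ x, x)` is a diffeomorphism** for a `C^n` global flow `θ`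
and a `C^n` time function `τ` constant along the orbits; its inverse is `x ↦ θ(-τ x, x)`.  With
`θ` the rotation flow of an annulus and `τ = 2πt` this is the twist map of Farb–Margalit, §3.1.1.
[cite: FarbMargalit2012, §3.1.1] [cite: LeeSmoothManifolds2013, Thm. 9.12] -/
def flowReparamDiffeomorph {θ : ℝ × M → M} {τ : M → ℝ}
    (hθ : ContMDiff (𝓘(ℝ, ℝ).prod I) I n θ) (h0 : ∀ x, θ (0, x) = x)
    (hadd : ∀ t s x, θ (t, θ (s, x)) = θ (t + s, x))
    (hτ : ContMDiff I 𝓘(ℝ, ℝ) n τ) (hinv : ∀ t x, τ (θ (t, x)) = τ x) :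
    Diffeomorph I I M M n where
  toFun := flowReparam θ τ
  invFun := flowReparam θ fun y => -τ y
  left_inv := flowReparam_neg_flowReparam h0 hadd hinv
  right_inv := flowReparam_flowReparam_neg h0 hadd hinv
  contMDiff_toFun := contMDiff_flowReparam hθ hτ
  contMDiff_invFun := contMDiff_flowReparam hθ ((contDiff_neg.contMDiff).comp hτ)

/-- `flowReparamDiffeomorph` on points. [folklore] -/
@[simp] theorem flowReparamDiffeomorph_apply {θ : ℝ × M → M} {τ : M → ℝ}
    (hθ : ContMDiff (𝓘(ℝ, ℝ).prod I) I n θ) (h0 : ∀ x, θ (0, x) = x)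
    (hadd : ∀ t s x, θ (t, θ (s, x)) = θ (t + s, x))
    (hτ : ContMDiff I 𝓘(ℝ, ℝ) n τ) (hinv : ∀ t x, τ (θ (t, x)) = τ x) (x : M) :
    flowReparamDiffeomorph hθ h0 hadd hτ hinv x = θ (τ x, x) := rfl

/-- The inverse of `flowReparamDiffeomorph` on points. [folklore] -/
@[simp] theorem flowReparamDiffeomorph_symm_apply {θ : ℝ × M → M} {τ : M → ℝ}
    (hθ : ContMDiff (𝓘(ℝ, ℝ).prod I) I n θ) (h0 : ∀ x, θ (0, x) = x)
    (hadd : ∀ t s x, θ (t, θ (s, x)) = θ (t + s, x))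
    (hτ : ContMDiff I 𝓘(ℝ, ℝ) n τ) (hinv : ∀ t x, τ (θ (t, x)) = τ x) (x : M) :
    (flowReparamDiffeomorph hθ h0 hadd hτ hinv).symm x = θ (-τ x, x) := rfl

end FlowReparamSmooth

end Literature.Geometry.Manifold

end
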